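import Literature.NumberTheory.Sieve.BombieriFriedlanderIwaniecTheorem7Weights
import Literature.NumberTheory.Sieve.BombieriFriedlanderIwaniecTheorem5Assembly
import HarnessLib

/-!
# Bombieri–Friedlander–Iwaniec 1986, Theorem 7 (§14) — step 2: Poisson summation in `m`

Topic `Literature/NumberTheory/Sieve`; continuation of `…Theorem7Weights`.  BFI, p. 245: "By
Lemma 2 we have `∑_{m ≡ a(ln)‾ (qr)} α(m) = α̂(0)/(qr) + (qr)⁻¹ ∑_{1≤|h|≤H} α̂(h/qr) e(−ah(ln)‾/qr)
 + O(x^ε/QR)` with `H = x^ε QR M⁻¹` and `∑_{(m,qr)=1} α(m) = φ(qr)/(qr) α̂(0) + O(x^ε)`.  Hence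
`Δ₀(M,N,L,Q,R) = ∑_{r∼R,(qr,aln)=1} ∑_{l∼L} δ_{lr} ∑_q γ(q) ∑_n β(n) (qr)⁻¹ ∑_{1≤|h|≤H} α̂(h/qr)
 e(−ah(ln)‾/qr) + O(x^{1+ε}M⁻¹)` ((14.2)).  Here the error term is admissible provided `M > x^{2ε}`
((14.3))."  This file proves the corresponding EXACT statement for the weighted sum `BFI.tripleT`
of `…Theorem7Weights` with the smooth weight `α = BFI.bump M Y` on `m`, one modulus `k = qr` at a
time, reusing the Poisson machinery of the tree's Theorem 5 pipeline (`…Theorem5Poisson`: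
`BFI.classSum`, `BFI.coprimeSum`, `BFI.oscSum`, `BFI.norm_classSum_sub_le`,
`BFI.norm_coprimeSum_sub_le`) and its error bookkeeping (`…Theorem5Assembly`:
`BFI.tailBound_H0_le`, `BFI.divisor_error_le`).  Everything here is PROVED; no named fact is
introduced.

## Contents

* `BFI.sum_Icc_filter_bump_eq` — the `m`-sums over `[1, Xm]` and over `BFI.mRange` agree;
  `BFI.congrW_bumpW_eq`, `BFI.coprW_bumpW_eq` — the congruence / coprimality counts with the
  weight `α(m)` in terms of `classSum (a (ln)‾)` and `coprimeSum`.
* `BFI.errP M Y H₀ j K k` — the Poisson error at the modulus `k`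
  (`k⁻¹ tailBound(Y,j,k,H₀) + φ(k)⁻¹ ∑_{d∣k} d⁻¹(2K(d)(M+2Y) + tailBound(Y,j,d,K(d)))`);
  **`BFI.abs_bracketT_bumpW_sub_le`** — at a modulus `k` coprime to `al`:
  `|bracket(k) − ∑_{n,(n,k)=1} β(n) Re(k⁻¹ oscSum(k, a(ln)‾, H₀))| ≤ (∑|β|) errP(k)` (the main terms
  `α̂₀/k` cancel exactly).
* `BFI.oscBr`, `BFI.oscQ`, **`BFI.tripleOsc`** — the oscillatory form of `Δ₀` (the main term of
  (14.2)), and **`BFI.tripleT_bumpW_le_osc`**: `Δ(α, β, γ) ≤ tripleOsc + Xn ∑_{r,l,q} errP(qr)`.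
* **`BFI.sum_errP_le`** — with the parameters of §12 (`Y = Mx^{−ε₁}`, `H₀ = ⌊2x^{2ε₁}QR/M⌋`,
  `K(d) = ⌊d x^{ε₁/2}/Y⌋`, `jε₁ ≥ 2 + 2ε₁`): `∑_{r∼R} ∑_{l∼L} ∑_{q≤Xq} errP(qr)
   ≤ 118 K_j (2L+1) x^{3ε₁/2} ∑_{q≤Xq} ∑_{r≤2R} τ(qr)/φ(qr)` — i.e. (14.3): the error is
  `≪ x^{1+ε} M⁻¹`.

## References

* E. Bombieri, J. B. Friedlander, H. Iwaniec, Acta Math. 156 (1986), 203–251: §2 Lemma 2 p. 209;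
  §12 p. 236; §14 (14.2)–(14.3) p. 245. [BombieriFriedlanderIwaniecActa1986]
-/

noncomputable section

open Finset Real MeasureTheory
open scoped ArithmeticFunction.sigma ContDiff FourierTransform

namespace Literature.NumberTheory.Sieve

namespace BFI

/-! ### The `m`-sums with the smooth weight -/

/-- For `0 < Y ≤ M` and `⌊2M + Y⌋ ≤ Xm`, the weight `α = bump M Y` vanishes at `m = 0` and beyond
`⌊2M + Y⌋`, so that filtered `α`-sums over `[1, Xm]` and over `mRange M Y = [0, ⌊2M+Y⌋]` agree.
[folklore] -/
theorem sum_Icc_filter_bump_eq {M Y : ℝ} (hY : 0 < Y) (hYM : Y ≤ M) {Xm : ℕ} (hXm : ⌊2 * M + Y⌋₊ ≤ Xm)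
    (P : ℕ → Prop) [DecidablePred P] :
    ∑ m ∈ (Icc 1 Xm).filter P, bump M Y m = ∑ m ∈ (mRange M Y).filter P, bump M Y m := by
  have hM : 0 ≤ M := hY.le.trans hYM
  -- both sides equal the sum over `(Icc 1 ⌊2M+Y⌋).filter P`
  have hL : ∑ m ∈ (Icc 1 Xm).filter P, bump M Y m = ∑ m ∈ (Icc 1 ⌊2 * M + Y⌋₊).filter P, bump M Y m := by
    symm
    refine Finset.sum_subset (Finset.filter_subset_filter _ (Finset.Icc_subset_Icc_right hXm)) ?_
    intro m hm hm'
    rw [Finset.mem_filter] at hm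
    have hmP : P m := hm.2
    have hmX : ⌊2 * M + Y⌋₊ < m := by
      by_contra h
      push Not at h
      exact hm' (Finset.mem_filter.2 ⟨Finset.mem_Icc.2 ⟨(Finset.mem_Icc.1 hm.1).1, h⟩, hmP⟩)
    exact bump_eq_zero_of_ge hY hM (le_of_lt (Nat.lt_of_floor_lt hmX))
  have hR : ∑ m ∈ (mRange M Y).filter P, bump M Y m = ∑ m ∈ (Icc 1 ⌊2 * M + Y⌋₊).filter P, bump M Y m := by
    symm
    refine Finset.sum_subset (Finset.filter_subset_filter _ fun m hm => ?_) ?_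
    · rw [mem_mRange]; exact (Finset.mem_Icc.1 hm).2
    · intro m hm hm'
      rw [Finset.mem_filter, mem_mRange] at hm
      have hm0 : m = 0 := by
        by_contra h0
        exact hm' (Finset.mem_filter.2 ⟨Finset.mem_Icc.2 ⟨Nat.one_le_iff_ne_zero.2 h0, hm.1⟩, hm.2⟩)
      rw [hm0, Nat.cast_zero]
      exact bump_eq_zero_of_le hY hM (by linarith)
  rw [hL, hR]

/-- **The congruence count with the smooth weight**: for `k ≥ 1` coprime to `a` and to `l`,
`∑_{m,n : lmn ≡ a (k)} α(m) β(n) = ∑_{n ≤ Xn, (n,k)=1} β(n) · classSum(k, a (ln)‾)`.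
[cite: BombieriFriedlanderIwaniecActa1986, §14 p. 245] -/
theorem congrW_bumpW_eq {a : ℤ} {M Y : ℝ} (hY : 0 < Y) (hYM : Y ≤ M) {Xm : ℕ} (hXm : ⌊2 * M + Y⌋₊ ≤ Xm)
    (Xn : ℕ) (β : ℕ → ℝ) {l k : ℕ} (hka : IsCoprime (k : ℤ) a) (hl : l.Coprime k) :
    congrW a Xm Xn (bumpW M Y) β l k =
      ∑ n ∈ (Icc 1 Xn).filter (fun n => n.Coprime k),
        β n * classSum M Y k ((a : ZMod k) * (((l * n : ℕ) : ZMod k))⁻¹) := by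
  unfold congrW
  rw [Finset.sum_comm, Finset.sum_filter]
  refine Finset.sum_congr rfl fun n _ => ?_
  by_cases hn : n.Coprime k
  · rw [if_pos hn]
    have hln : (l * n).Coprime k := Nat.Coprime.mul_left hl hn
    calc ∑ m ∈ Icc 1 Xm, (if ((l * m * n : ℕ) : ZMod k) = (a : ZMod k) then bumpW M Y m * β n else 0)
        = ∑ m ∈ (Icc 1 Xm).filter (fun m : ℕ => (m : ZMod k) = (a : ZMod k) * (((l * n : ℕ) : ZMod k))⁻¹),
            β n * bump M Y m := by
          rw [Finset.sum_filter]
          refine Finset.sum_congr rfl fun m _ => ?_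
          rw [show l * m * n = m * (l * n) by ring]
          by_cases h : (m : ZMod k) = (a : ZMod k) * (((l * n : ℕ) : ZMod k))⁻¹
          · rw [if_pos ((natCast_mul_eq_iff hln _).2 h), if_pos h, bumpW, mul_comm]
          · rw [if_neg (mt (natCast_mul_eq_iff hln _).1 h), if_neg h]
      _ = β n * classSum M Y k ((a : ZMod k) * (((l * n : ℕ) : ZMod k))⁻¹) := by
          rw [← Finset.mul_sum, classSum, sum_Icc_filter_bump_eq hY hYM hXm]
  · rw [if_neg hn]
    refine Finset.sum_eq_zero fun m _ => ?_
    rw [if_neg]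
    intro h
    rw [show l * m * n = n * (l * m) by ring] at h
    exact hn (coprime_of_natCast_mul_eq hka h).symm

/-- **The coprimality count with the smooth weight**:
`∑_{m,n : (mn,k)=1} α(m) β(n) = (∑_{n ≤ Xn, (n,k)=1} β(n)) · coprimeSum(k)`. [folklore] -/
theorem coprW_bumpW_eq {M Y : ℝ} (hY : 0 < Y) (hYM : Y ≤ M) {Xm : ℕ} (hXm : ⌊2 * M + Y⌋₊ ≤ Xm)
    (Xn : ℕ) (β : ℕ → ℝ) (k : ℕ) :
    coprW Xm Xn (bumpW M Y) β k =
      (∑ n ∈ (Icc 1 Xn).filter (fun n => n.Coprime k), β n) * coprimeSum M Y k := by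
  unfold coprW
  rw [Finset.sum_comm, Finset.sum_filter, Finset.sum_mul]
  refine Finset.sum_congr rfl fun n _ => ?_
  by_cases hn : n.Coprime k
  · rw [if_pos hn, coprimeSum, ← sum_Icc_filter_bump_eq hY hYM hXm, Finset.mul_sum, Finset.sum_filter]
    refine Finset.sum_congr rfl fun m _ => ?_
    have : (m * n).Coprime k ↔ m.Coprime k :=
      ⟨fun h => Nat.Coprime.coprime_mul_right h, fun h => Nat.Coprime.mul_left h hn⟩
    simp only [this, bumpW]
    split_ifs <;> ring
  · rw [if_neg hn, zero_mul]
    refine Finset.sum_eq_zero fun m _ => ?_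
    rw [if_neg]
    intro h
    exact hn (Nat.Coprime.coprime_mul_left h)

/-! ### The bracket at one modulus after Poisson summation -/

/-- The Poisson error at the modulus `k`:
`k⁻¹ tailBound(Y, j, k, H₀) + φ(k)⁻¹ ∑_{d∣k} d⁻¹ (2K(d)(M + 2Y) + tailBound(Y, j, d, K(d)))`.
[cite: BombieriFriedlanderIwaniecActa1986, §12 p. 236] -/
def errP (M Y : ℝ) (H₀ j : ℕ) (K : ℕ → ℕ) (k : ℕ) : ℝ :=
  (k : ℝ)⁻¹ * tailBound Y j k H₀ +
    (∑ d ∈ k.divisors, (d : ℝ)⁻¹ * (2 * K d * (M + 2 * Y) + tailBound Y j d (K d))) /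
      (Nat.totient k : ℝ)

/-- `errP ≥ 0` for `Y > 0`. [folklore] -/
theorem errP_nonneg (M : ℝ) {Y : ℝ} (hY : 0 < Y) (hM : 0 ≤ M) (H₀ j : ℕ) (K : ℕ → ℕ) (k : ℕ) :
    0 ≤ errP M Y H₀ j K k := by
  unfold errP
  have h1 := tailBound_nonneg hY j k H₀
  have h2 : 0 ≤ ∑ d ∈ k.divisors, (d : ℝ)⁻¹ * (2 * K d * (M + 2 * Y) + tailBound Y j d (K d)) :=
    Finset.sum_nonneg fun d _ => by
      have := tailBound_nonneg hY j d (K d); positivity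
  positivity

/-- The oscillatory bracket at the modulus `k`:
`∑_{n ≤ Xn, (n,k)=1} β(n) Re(k⁻¹ oscSum(k, a (ln)‾, H₀))` — the main term of (14.2) at `k = qr`.
[cite: BombieriFriedlanderIwaniecActa1986, §14 (14.2) p. 245] -/
def oscBr (a : ℤ) (M Y : ℝ) (H₀ Xn : ℕ) (β : ℕ → ℝ) (l k : ℕ) : ℝ :=
  ∑ n ∈ (Icc 1 Xn).filter (fun n => n.Coprime k),
    β n * ((k : ℂ)⁻¹ * oscSum M Y k ((a : ZMod k) * (((l * n : ℕ) : ZMod k))⁻¹) H₀).re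

/-- **The bracket at one modulus after Poisson summation** (BFI (14.2), one modulus at a time):
for `k ≥ 1` coprime to `a` and to `l`, `0 < Y ≤ M`, `⌊2M+Y⌋ ≤ Xm`, `j ≥ 2`,
`|bracket(k; α, β) − oscBr(k)| ≤ (∑_{n ≤ Xn} |β(n)|) · errP(k)`: the main terms `α̂₀/k` of the
congruence sums and of the coprimality sum cancel exactly.
[cite: BombieriFriedlanderIwaniecActa1986, §14 (14.2) p. 245; §12 p. 236] -/
theorem abs_bracketT_bumpW_sub_le {a : ℤ} {M Y : ℝ} (hY : 0 < Y) (hYM : Y ≤ M) {Xm : ℕ}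
    (hXm : ⌊2 * M + Y⌋₊ ≤ Xm) (Xn : ℕ) (β : ℕ → ℝ) {l k : ℕ} (hk : 0 < k)
    (hka : IsCoprime (k : ℤ) a) (hl : l.Coprime k) (H₀ : ℕ) {j : ℕ} (hj : 2 ≤ j) (K : ℕ → ℕ) :
    |bracketT a Xm Xn (bumpW M Y) β l k - oscBr a M Y H₀ Xn β l k| ≤
      (∑ n ∈ Icc 1 Xn, |β n|) * errP M Y H₀ j K k := by
  set F : Finset ℕ := (Icc 1 Xn).filter (fun n => n.Coprime k) with hF
  set c : ℕ → ZMod k := fun n => (a : ZMod k) * (((l * n : ℕ) : ZMod k))⁻¹ with hc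
  set Scls : ℂ := ∑ n ∈ F, (β n : ℂ) * (classSum M Y k (c n) : ℂ) with hScls
  set Sosc : ℂ := ∑ n ∈ F, (β n : ℂ) * oscSum M Y k (c n) H₀ with hSosc
  set Sβ : ℂ := ∑ n ∈ F, (β n : ℂ) with hSβ
  set cop : ℂ := (coprimeSum M Y k : ℂ) with hcop
  set φ : ℂ := (Nat.totient k : ℂ) with hφ
  have hφ0 : φ ≠ 0 := by rw [hφ]; exact_mod_cast (Nat.totient_pos.2 hk).ne'
  have hk0 : (k : ℂ) ≠ 0 := by exact_mod_cast hk.ne'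
  have hM : 0 ≤ M := hY.le.trans hYM
  set errB : ℝ := ∑ d ∈ k.divisors, (d : ℝ)⁻¹ * (2 * K d * (M + 2 * Y) + tailBound Y j d (K d))
    with herrB
  -- the bracket in terms of `classSum` and `coprimeSum`
  have hbr : ((bracketT a Xm Xn (bumpW M Y) β l k : ℝ) : ℂ) = Scls - Sβ * cop / φ := by
    rw [bracketT, congrW_bumpW_eq hY hYM hXm Xn β hka hl, coprW_bumpW_eq hY hYM hXm Xn β k]
    simp only [hScls, hSβ, hcop, hφ, hF, hc]
    push_cast
    ring
  -- the oscillatory bracket is the real part of `k⁻¹ Sosc`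
  have hosc : oscBr a M Y H₀ Xn β l k = ((k : ℂ)⁻¹ * Sosc).re := by
    rw [oscBr, hSosc, Finset.mul_sum, Complex.re_sum]
    refine Finset.sum_congr rfl fun n _ => ?_
    rw [← mul_assoc, mul_comm ((k : ℂ)⁻¹) ((β n : ℂ)), mul_assoc, Complex.re_ofReal_mul]
  -- `|x − Re z| ≤ ‖x − z‖` for real `x`
  have hre : |bracketT a Xm Xn (bumpW M Y) β l k - oscBr a M Y H₀ Xn β l k| ≤
      ‖((bracketT a Xm Xn (bumpW M Y) β l k : ℝ) : ℂ) - (k : ℂ)⁻¹ * Sosc‖ := by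
    have : bracketT a Xm Xn (bumpW M Y) β l k - oscBr a M Y H₀ Xn β l k =
        (((bracketT a Xm Xn (bumpW M Y) β l k : ℝ) : ℂ) - (k : ℂ)⁻¹ * Sosc).re := by
      rw [hosc, Complex.sub_re, Complex.ofReal_re]
    rw [this]
    exact Complex.abs_re_le_norm _
  refine hre.trans ?_
  -- the algebraic recombination (the main terms `α̂₀/k` cancel)
  have hid : (Scls - Sβ * cop / φ) - (k : ℂ)⁻¹ * Sosc =
      (Scls - (k : ℂ)⁻¹ * (alphaHat M Y * Sβ + Sosc)) -
        Sβ * (cop - alphaHat M Y * (φ / k)) / φ := by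
    field_simp
    ring
  have hT1 : Scls - (k : ℂ)⁻¹ * (alphaHat M Y * Sβ + Sosc) =
      ∑ n ∈ F, (β n : ℂ) * ((classSum M Y k (c n) : ℂ) -
        (k : ℂ)⁻¹ * (alphaHat M Y + oscSum M Y k (c n) H₀)) := by
    simp only [hScls, hSosc, hSβ, mul_sub, mul_add, Finset.sum_sub_distrib, Finset.sum_add_distrib,
      Finset.mul_sum]
    congr 1
    congr 1 <;> refine Finset.sum_congr rfl fun n _ => ?_ <;> ring
  rw [hbr, hid, hT1]
  refine (norm_sub_le _ _).trans ?_
  have hβF : ∑ n ∈ F, |β n| ≤ ∑ n ∈ Icc 1 Xn, |β n| :=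
    Finset.sum_le_sum_of_subset_of_nonneg (Finset.filter_subset _ _) fun n _ _ => abs_nonneg _
  have hβ0 : 0 ≤ ∑ n ∈ Icc 1 Xn, |β n| := Finset.sum_nonneg fun n _ => abs_nonneg _
  have htail0 : 0 ≤ (k : ℝ)⁻¹ * tailBound Y j k H₀ := by
    have := tailBound_nonneg hY j k H₀; positivity
  have herr0 : 0 ≤ errB := by
    refine Finset.sum_nonneg fun d _ => ?_
    have := tailBound_nonneg hY j d (K d); positivity
  -- first term
  have h1 : ‖∑ n ∈ F, (β n : ℂ) * ((classSum M Y k (c n) : ℂ) -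
      (k : ℂ)⁻¹ * (alphaHat M Y + oscSum M Y k (c n) H₀))‖ ≤
      (∑ n ∈ Icc 1 Xn, |β n|) * ((k : ℝ)⁻¹ * tailBound Y j k H₀) := by
    refine (norm_sum_le _ _).trans ?_
    calc ∑ n ∈ F, ‖(β n : ℂ) * ((classSum M Y k (c n) : ℂ) -
          (k : ℂ)⁻¹ * (alphaHat M Y + oscSum M Y k (c n) H₀))‖
        ≤ ∑ n ∈ F, |β n| * ((k : ℝ)⁻¹ * tailBound Y j k H₀) := by
          refine Finset.sum_le_sum fun n _ => ?_
          rw [norm_mul, Complex.norm_real, Real.norm_eq_abs]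
          exact mul_le_mul_of_nonneg_left (norm_classSum_sub_le hY hYM hk (c n) H₀ hj)
            (abs_nonneg _)
      _ = (∑ n ∈ F, |β n|) * ((k : ℝ)⁻¹ * tailBound Y j k H₀) := by rw [Finset.sum_mul]
      _ ≤ (∑ n ∈ Icc 1 Xn, |β n|) * ((k : ℝ)⁻¹ * tailBound Y j k H₀) :=
          mul_le_mul_of_nonneg_right hβF htail0
  -- second term
  have h2 : ‖Sβ * (cop - alphaHat M Y * (φ / k)) / φ‖ ≤
      (∑ n ∈ Icc 1 Xn, |β n|) * (errB / (Nat.totient k : ℝ)) := by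
    rw [norm_div, norm_mul, hφ, Complex.norm_natCast]
    have hSβ_le : ‖Sβ‖ ≤ ∑ n ∈ Icc 1 Xn, |β n| := by
      refine (norm_sum_le _ _).trans (le_trans (le_of_eq ?_) hβF)
      refine Finset.sum_congr rfl fun n _ => ?_
      rw [Complex.norm_real, Real.norm_eq_abs]
    have hE2 := norm_coprimeSum_sub_le hY hYM hk hj K
    rw [← hcop, ← herrB] at hE2
    have hφpos : (0 : ℝ) < (Nat.totient k : ℝ) := by exact_mod_cast Nat.totient_pos.2 hk
    rw [mul_div_assoc]
    have hE2' : ‖cop - alphaHat M Y * (φ / k)‖ / (Nat.totient k : ℝ) ≤ errB / (Nat.totient k : ℝ) :=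
      by rw [div_le_div_iff_of_pos_right hφpos]; exact hE2
    exact mul_le_mul hSβ_le hE2' (by positivity) hβ0
  calc ‖∑ n ∈ F, (β n : ℂ) * ((classSum M Y k (c n) : ℂ) -
        (k : ℂ)⁻¹ * (alphaHat M Y + oscSum M Y k (c n) H₀))‖ +
        ‖Sβ * (cop - alphaHat M Y * (φ / k)) / φ‖
      ≤ (∑ n ∈ Icc 1 Xn, |β n|) * ((k : ℝ)⁻¹ * tailBound Y j k H₀) +
          (∑ n ∈ Icc 1 Xn, |β n|) * (errB / (Nat.totient k : ℝ)) := add_le_add h1 h2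
    _ = _ := by rw [herrB, errP]; ring

/-! ### The oscillatory form of `Δ₀` -/

/-- The weighted `q`-sum of the oscillatory brackets at `(r, l)`. [cite: BombieriFriedlanderIwaniecActa1986, §14 (14.2) p. 245] -/
def oscQ (a : ℤ) (M Y : ℝ) (H₀ Xn Xq : ℕ) (β γ : ℕ → ℝ) (r l : ℕ) : ℝ :=
  ∑ q ∈ (Icc 1 Xq).filter (fun q : ℕ => IsCoprime (q : ℤ) (a * l)), γ q * oscBr a M Y H₀ Xn β l (q * r)

/-- **The main term of (14.2)**: `∑_{r∼R,(r,a)=1} ∑_{l∼L,(l,r)=1} |∑_{q,(q,al)=1} γ(q)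
∑_{n,(n,qr)=1} β(n) Re((qr)⁻¹ ∑_{1≤|h|≤H₀} α̂(h/qr) e(h a(ln)‾/qr))|`.
[cite: BombieriFriedlanderIwaniecActa1986, §14 (14.2) p. 245] -/
def tripleOsc (a : ℤ) (M Y : ℝ) (H₀ Xn Xq : ℕ) (β γ : ℕ → ℝ) (L R : ℝ) : ℝ :=
  ∑ r ∈ (dyadic R).filter (fun r : ℕ => IsCoprime (r : ℤ) a),
    ∑ l ∈ (dyadic L).filter (fun l : ℕ => l.Coprime r), |oscQ a M Y H₀ Xn Xq β γ r l|

/-- `tripleOsc ≥ 0`. [folklore] -/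
theorem tripleOsc_nonneg (a : ℤ) (M Y : ℝ) (H₀ Xn Xq : ℕ) (β γ : ℕ → ℝ) (L R : ℝ) :
    0 ≤ tripleOsc a M Y H₀ Xn Xq β γ L R :=
  Finset.sum_nonneg fun _ _ => Finset.sum_nonneg fun _ _ => abs_nonneg _

/-- Coprimality bookkeeping inside `Δ`: for `(r, a) = 1`, `(l, r) = 1`, `(q, al) = 1` the modulus
`qr` is coprime to `a` and to `l`. [folklore] -/
theorem coprime_modulus {a : ℤ} {q r l : ℕ} (hra : IsCoprime (r : ℤ) a) (hlr : l.Coprime r)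
    (hq : IsCoprime (q : ℤ) (a * l)) :
    IsCoprime ((q * r : ℕ) : ℤ) a ∧ l.Coprime (q * r) := by
  constructor
  · rw [Nat.cast_mul]
    exact IsCoprime.mul_left (IsCoprime.of_mul_right_left hq) hra
  · refine Nat.Coprime.mul_right ?_ hlr
    have h : IsCoprime (q : ℤ) (l : ℤ) := IsCoprime.of_mul_right_right hq
    exact (Nat.isCoprime_iff_coprime.1 h).symm

/-- **`Δ(α, β, γ) ≤ tripleOsc + Xn ∑_{r,l,q} errP(qr)`** for `|β|, |γ| ≤ 1`, `0 < Y ≤ M`,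
`⌊2M+Y⌋ ≤ Xm`, `j ≥ 2` ((14.2) with its error term, before the choice of parameters).
[cite: BombieriFriedlanderIwaniecActa1986, §14 (14.2) p. 245] -/
theorem tripleT_bumpW_le_osc {a : ℤ} {M Y : ℝ} (hY : 0 < Y) (hYM : Y ≤ M) {Xm : ℕ}
    (hXm : ⌊2 * M + Y⌋₊ ≤ Xm) (Xn Xq : ℕ) {β γ : ℕ → ℝ} (hβ : ∀ n, |β n| ≤ 1) (hγ : ∀ q, |γ q| ≤ 1)
    (H₀ : ℕ) {j : ℕ} (hj : 2 ≤ j) (K : ℕ → ℕ) {L R : ℝ} (hR : 0 ≤ R) :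
    tripleT a Xm Xn Xq (bumpW M Y) β γ L R ≤
      tripleOsc a M Y H₀ Xn Xq β γ L R +
        (Xn : ℝ) * ∑ r ∈ dyadic R, ∑ _l ∈ dyadic L, ∑ q ∈ Icc 1 Xq, errP M Y H₀ j K (q * r) := by
  have hM : 0 ≤ M := hY.le.trans hYM
  have hβsum : ∑ n ∈ Icc 1 Xn, |β n| ≤ Xn := by
    calc ∑ n ∈ Icc 1 Xn, |β n| ≤ ∑ _n ∈ Icc 1 Xn, (1 : ℝ) := Finset.sum_le_sum fun n _ => hβ n
      _ = Xn := by simp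
  have herr0 : ∀ k, 0 ≤ errP M Y H₀ j K k := fun k => errP_nonneg M hY hM H₀ j K k
  set E : ℕ → ℝ := fun r => (Xn : ℝ) * ∑ q ∈ Icc 1 Xq, errP M Y H₀ j K (q * r) with hE
  have hE0 : ∀ r, 0 ≤ E r := fun r => mul_nonneg (Nat.cast_nonneg _) (Finset.sum_nonneg fun q _ => herr0 _)
  -- Step A: termwise, `|qSumT| ≤ |oscQ| + E r`
  have hA : ∀ r ∈ (dyadic R).filter (fun r : ℕ => IsCoprime (r : ℤ) a),
      ∀ l ∈ (dyadic L).filter (fun l : ℕ => l.Coprime r),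
        |qSumT a Xm Xn Xq (bumpW M Y) β γ r l| ≤ |oscQ a M Y H₀ Xn Xq β γ r l| + E r := by
    intro r hr l hl
    have hr' := Finset.mem_filter.1 hr
    have hl' := Finset.mem_filter.1 hl
    have hr0 : 0 < r := pos_of_mem_dyadic hR hr'.1
    have hdiff : |qSumT a Xm Xn Xq (bumpW M Y) β γ r l - oscQ a M Y H₀ Xn Xq β γ r l| ≤ E r := by
      unfold qSumT oscQ
      rw [← Finset.sum_sub_distrib]
      refine (Finset.abs_sum_le_sum_abs _ _).trans ?_
      calc ∑ q ∈ (Icc 1 Xq).filter (fun q : ℕ => IsCoprime (q : ℤ) (a * l)),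
            |γ q * bracketT a Xm Xn (bumpW M Y) β l (q * r) - γ q * oscBr a M Y H₀ Xn β l (q * r)|
          ≤ ∑ q ∈ (Icc 1 Xq).filter (fun q : ℕ => IsCoprime (q : ℤ) (a * l)),
              (Xn : ℝ) * errP M Y H₀ j K (q * r) := by
            refine Finset.sum_le_sum fun q hq => ?_
            have hq' := Finset.mem_filter.1 hq
            have hq0 : 0 < q := (Finset.mem_Icc.1 hq'.1).1
            obtain ⟨hka, hlk⟩ := coprime_modulus hr'.2 hl'.2 hq'.2
            rw [← mul_sub, abs_mul]
            calc |γ q| * |bracketT a Xm Xn (bumpW M Y) β l (q * r) - oscBr a M Y H₀ Xn β l (q * r)|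
                ≤ 1 * ((∑ n ∈ Icc 1 Xn, |β n|) * errP M Y H₀ j K (q * r)) :=
                  mul_le_mul (hγ q) (abs_bracketT_bumpW_sub_le hY hYM hXm Xn β (Nat.mul_pos hq0 hr0)
                    hka hlk H₀ hj K) (abs_nonneg _) zero_le_one
              _ ≤ (Xn : ℝ) * errP M Y H₀ j K (q * r) := by
                  rw [one_mul]
                  exact mul_le_mul_of_nonneg_right hβsum (herr0 _)
        _ ≤ ∑ q ∈ Icc 1 Xq, (Xn : ℝ) * errP M Y H₀ j K (q * r) :=
            Finset.sum_le_sum_of_subset_of_nonneg (Finset.filter_subset _ _) fun q _ _ =>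
              mul_nonneg (Nat.cast_nonneg _) (herr0 _)
        _ = E r := by simp only [hE]; rw [Finset.mul_sum]
    have := abs_sub_abs_le_abs_sub (qSumT a Xm Xn Xq (bumpW M Y) β γ r l) (oscQ a M Y H₀ Xn Xq β γ r l)
    linarith
  -- Steps B–D
  unfold tripleT tripleOsc
  calc ∑ r ∈ (dyadic R).filter (fun r : ℕ => IsCoprime (r : ℤ) a),
        ∑ l ∈ (dyadic L).filter (fun l : ℕ => l.Coprime r), |qSumT a Xm Xn Xq (bumpW M Y) β γ r l|
      ≤ ∑ r ∈ (dyadic R).filter (fun r : ℕ => IsCoprime (r : ℤ) a),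
          ∑ l ∈ (dyadic L).filter (fun l : ℕ => l.Coprime r), (|oscQ a M Y H₀ Xn Xq β γ r l| + E r) :=
        Finset.sum_le_sum fun r hr => Finset.sum_le_sum fun l hl => hA r hr l hl
    _ = (∑ r ∈ (dyadic R).filter (fun r : ℕ => IsCoprime (r : ℤ) a),
          ∑ l ∈ (dyadic L).filter (fun l : ℕ => l.Coprime r), |oscQ a M Y H₀ Xn Xq β γ r l|) +
          ∑ r ∈ (dyadic R).filter (fun r : ℕ => IsCoprime (r : ℤ) a),
            ∑ _l ∈ (dyadic L).filter (fun l : ℕ => l.Coprime r), E r := by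
        rw [← Finset.sum_add_distrib]
        refine Finset.sum_congr rfl fun r _ => ?_
        rw [Finset.sum_add_distrib]
    _ ≤ (∑ r ∈ (dyadic R).filter (fun r : ℕ => IsCoprime (r : ℤ) a),
          ∑ l ∈ (dyadic L).filter (fun l : ℕ => l.Coprime r), |oscQ a M Y H₀ Xn Xq β γ r l|) +
          ∑ r ∈ dyadic R, ∑ _l ∈ dyadic L, E r := by
        gcongr ?_ + ?_
        · exact le_rfl
        calc ∑ r ∈ (dyadic R).filter (fun r : ℕ => IsCoprime (r : ℤ) a),
              ∑ _l ∈ (dyadic L).filter (fun l : ℕ => l.Coprime r), E r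
            ≤ ∑ r ∈ (dyadic R).filter (fun r : ℕ => IsCoprime (r : ℤ) a), ∑ _l ∈ dyadic L, E r :=
              Finset.sum_le_sum fun r _ => Finset.sum_le_sum_of_subset_of_nonneg (Finset.filter_subset _ _)
                fun l _ _ => hE0 r
          _ ≤ ∑ r ∈ dyadic R, ∑ _l ∈ dyadic L, E r :=
              Finset.sum_le_sum_of_subset_of_nonneg (Finset.filter_subset _ _) fun r _ _ =>
                Finset.sum_nonneg fun l _ => hE0 r
    _ = _ := by
        congr 1
        rw [hE, Finset.mul_sum]
        refine Finset.sum_congr rfl fun r _ => ?_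
        rw [Finset.mul_sum]

/-! ### The Poisson errors with the parameters of §12 ((14.3)) -/

/-- **The Poisson error at one modulus with the parameters of §12**: with `Y = Mx^{−ε₁}`,
`H₀ = ⌊x^{2ε₁}(2Q)R/M⌋`, `K(d) = ⌊d x^{ε₁/2}/Y⌋`, `jε₁ ≥ 2 + 2ε₁`, `1 ≤ M ≤ x`, `2QR < x`, at a
modulus `k ≤ 8QR`: `errP(k) ≤ 118 K_j x^{3ε₁/2} τ(k)/φ(k)` (tree: `tailBound_H0_le`,
`divisor_error_le`). [cite: BombieriFriedlanderIwaniecActa1986, §12 p. 236; §14 (14.3) p. 245] -/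
theorem errP_le {x M Q R ε₁ : ℝ} (hx : 1 ≤ x) (hM1 : 1 ≤ M) (hMx : M ≤ x) (hQ : 0 < Q) (hR : 0 < R)
    (hQR : 2 * Q * R < x) (hε₁ : 0 < ε₁) {j : ℕ} (hj : 1 ≤ j) (hjε : 2 + 2 * ε₁ ≤ j * ε₁)
    {k : ℕ} (hk : 0 < k) (hk8 : (k : ℝ) ≤ 8 * Q * R) :
    errP M (M * x ^ (-ε₁)) ⌊x ^ (2 * ε₁) * (2 * Q) * R / M⌋₊ j
        (fun d => ⌊(d : ℝ) * x ^ (ε₁ / 2) / (M * x ^ (-ε₁))⌋₊) k ≤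
      118 * derivConst j * x ^ (3 * ε₁ / 2) * ((σ 0 k : ℝ) / (Nat.totient k : ℝ)) := by
  have hx0 : 0 < x := by linarith
  have hKj := one_le_derivConst j
  have hk0 : (0 : ℝ) < k := by exact_mod_cast hk
  have hφ0 : (0 : ℝ) < (Nat.totient k : ℝ) := by exact_mod_cast Nat.totient_pos.2 hk
  -- the tail
  have htail : tailBound (M * x ^ (-ε₁)) j k ⌊x ^ (2 * ε₁) * (2 * Q) * R / M⌋₊ ≤
      32 * derivConst j * x⁻¹ :=
    tailBound_H0_le hx hM1 hMx (by positivity) hR (by linarith) hε₁ hj hjε (by linarith)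
  -- the divisor terms
  have hdiv : ∑ d ∈ k.divisors, (d : ℝ)⁻¹ * (2 * (⌊(d : ℝ) * x ^ (ε₁ / 2) / (M * x ^ (-ε₁))⌋₊ : ℕ) *
      (M + 2 * (M * x ^ (-ε₁))) + tailBound (M * x ^ (-ε₁)) j d ⌊(d : ℝ) * x ^ (ε₁ / 2) / (M * x ^ (-ε₁))⌋₊) ≤
      (σ 0 k : ℝ) * (86 * derivConst j * x ^ (3 * ε₁ / 2)) := by
    calc _ ≤ ∑ _d ∈ k.divisors, 86 * derivConst j * x ^ (3 * ε₁ / 2) := by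
          refine Finset.sum_le_sum fun d hd => ?_
          have hd' := Nat.mem_divisors.1 hd
          have hd0 : 0 < d := Nat.pos_of_mem_divisors hd
          have hdk : d ≤ k := Nat.divisor_le hd
          have hdx : (d : ℝ) ≤ 4 * x := by
            have : (d : ℝ) ≤ k := by exact_mod_cast hdk
            linarith
          exact divisor_error_le hx hM1 hMx hε₁ hj hjε hd0 hdx
      _ = (σ 0 k : ℝ) * (86 * derivConst j * x ^ (3 * ε₁ / 2)) := by
          rw [Finset.sum_const, nsmul_eq_mul, ArithmeticFunction.sigma_zero_apply]
  -- `k⁻¹ ≤ τ(k)/φ(k)` and `x⁻¹ ≤ x^{3ε₁/2}`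
  have hσ1 : (1 : ℝ) ≤ (σ 0 k : ℝ) := by exact_mod_cast one_le_sigma_zero hk.ne'
  have hkinv : (k : ℝ)⁻¹ ≤ (σ 0 k : ℝ) / (Nat.totient k : ℝ) := by
    rw [le_div_iff₀ hφ0]
    have hφk : (Nat.totient k : ℝ) ≤ k := by exact_mod_cast Nat.totient_le k
    calc (k : ℝ)⁻¹ * (Nat.totient k : ℝ) ≤ (k : ℝ)⁻¹ * k := by gcongr
      _ = 1 := inv_mul_cancel₀ hk0.ne'
      _ ≤ (σ 0 k : ℝ) := hσ1
  have hxinv : x⁻¹ ≤ x ^ (3 * ε₁ / 2) := by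
    calc x⁻¹ ≤ 1 := inv_le_one_of_one_le₀ hx
      _ ≤ x ^ (3 * ε₁ / 2) := Real.one_le_rpow hx (by positivity)
  have htail0 := tailBound_nonneg (show 0 < M * x ^ (-ε₁) by positivity) j k ⌊x ^ (2 * ε₁) * (2 * Q) * R / M⌋₊
  unfold errP
  calc (k : ℝ)⁻¹ * tailBound (M * x ^ (-ε₁)) j k ⌊x ^ (2 * ε₁) * (2 * Q) * R / M⌋₊ +
        (∑ d ∈ k.divisors, (d : ℝ)⁻¹ * (2 * (⌊(d : ℝ) * x ^ (ε₁ / 2) / (M * x ^ (-ε₁))⌋₊ : ℕ) *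
          (M + 2 * (M * x ^ (-ε₁))) +
            tailBound (M * x ^ (-ε₁)) j d ⌊(d : ℝ) * x ^ (ε₁ / 2) / (M * x ^ (-ε₁))⌋₊)) / (Nat.totient k : ℝ)
      ≤ ((σ 0 k : ℝ) / (Nat.totient k : ℝ)) * (32 * derivConst j * x⁻¹) +
          (σ 0 k : ℝ) * (86 * derivConst j * x ^ (3 * ε₁ / 2)) / (Nat.totient k : ℝ) := by
        refine add_le_add (mul_le_mul hkinv htail htail0 (by positivity)) ?_
        rw [div_le_div_iff_of_pos_right hφ0]
        exact hdiv
    _ = ((σ 0 k : ℝ) / (Nat.totient k : ℝ)) * (32 * derivConst j * x⁻¹ + 86 * derivConst j * x ^ (3 * ε₁ / 2)) := by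
        ring
    _ ≤ ((σ 0 k : ℝ) / (Nat.totient k : ℝ)) *
          (32 * derivConst j * x ^ (3 * ε₁ / 2) + 86 * derivConst j * x ^ (3 * ε₁ / 2)) := by
        gcongr
    _ = 118 * derivConst j * x ^ (3 * ε₁ / 2) * ((σ 0 k : ℝ) / (Nat.totient k : ℝ)) := by ring

/-- **The total Poisson error ((14.3))**: summed over `r ∼ R`, `l ∼ L`, `q ≤ Xq ≤ 4Q`,
`∑ errP(qr) ≤ (2L + 1) · 118 K_j x^{3ε₁/2} · ∑_{q ≤ Xq} ∑_{r ≤ 2R} τ(qr)/φ(qr)`; with the factor `Xn ≍ N`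
of `tripleT_bumpW_le_osc` this is `≪ x^{1+2ε₁} LN/… = x^{1+ε} M⁻¹`, admissible once `M > x^{2ε}`.
[cite: BombieriFriedlanderIwaniecActa1986, §14 (14.3) p. 245] -/
theorem sum_errP_le {x M Q R ε₁ : ℝ} (hx : 1 ≤ x) (hM1 : 1 ≤ M) (hMx : M ≤ x) (hQ : 0 < Q) (hR : 0 < R)
    (hQR : 2 * Q * R < x) (hε₁ : 0 < ε₁) {j : ℕ} (hj : 1 ≤ j) (hjε : 2 + 2 * ε₁ ≤ j * ε₁)
    {Xq : ℕ} (hXq : (Xq : ℝ) ≤ 4 * Q) {L : ℝ} (hL : 0 ≤ L) :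
    ∑ r ∈ dyadic R, ∑ _l ∈ dyadic L, ∑ q ∈ Icc 1 Xq,
        errP M (M * x ^ (-ε₁)) ⌊x ^ (2 * ε₁) * (2 * Q) * R / M⌋₊ j
          (fun d => ⌊(d : ℝ) * x ^ (ε₁ / 2) / (M * x ^ (-ε₁))⌋₊) (q * r) ≤
      (2 * L + 1) * (118 * derivConst j * x ^ (3 * ε₁ / 2)) *
        ∑ q ∈ Icc 1 Xq, ∑ r ∈ Icc 1 ⌊2 * R⌋₊, (σ 0 (q * r) : ℝ) / (Nat.totient (q * r) : ℝ) := by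
  have hx0 : 0 < x := by linarith
  set c : ℝ := 118 * derivConst j * x ^ (3 * ε₁ / 2) with hc
  have hc0 : 0 ≤ c := by have := one_le_derivConst j; positivity
  have hone : ∀ r ∈ Icc 1 ⌊2 * R⌋₊, ∀ q ∈ Icc 1 Xq,
      errP M (M * x ^ (-ε₁)) ⌊x ^ (2 * ε₁) * (2 * Q) * R / M⌋₊ j
          (fun d => ⌊(d : ℝ) * x ^ (ε₁ / 2) / (M * x ^ (-ε₁))⌋₊) (q * r) ≤
        c * ((σ 0 (q * r) : ℝ) / (Nat.totient (q * r) : ℝ)) := by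
    intro r hr q hq
    have hr' := Finset.mem_Icc.1 hr
    have hq' := Finset.mem_Icc.1 hq
    have hr2 : (r : ℝ) ≤ 2 * R := by
      have : (r : ℝ) ≤ ⌊2 * R⌋₊ := by exact_mod_cast hr'.2
      exact this.trans (Nat.floor_le (by linarith))
    have hq4 : (q : ℝ) ≤ 4 * Q := le_trans (by exact_mod_cast hq'.2) hXq
    have hk8 : ((q * r : ℕ) : ℝ) ≤ 8 * Q * R := by
      push_cast
      have hq0 : (0 : ℝ) ≤ q := Nat.cast_nonneg q
      calc (q : ℝ) * r ≤ (4 * Q) * (2 * R) := mul_le_mul hq4 hr2 (Nat.cast_nonneg r) (by positivity)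
        _ = 8 * Q * R := by ring
    exact errP_le hx hM1 hMx hQ hR hQR hε₁ hj hjε (Nat.mul_pos hq'.1 hr'.1) hk8
  have hσφ0 : ∀ q r : ℕ, 0 ≤ (σ 0 (q * r) : ℝ) / (Nat.totient (q * r) : ℝ) := fun q r => by positivity
  calc ∑ r ∈ dyadic R, ∑ _l ∈ dyadic L, ∑ q ∈ Icc 1 Xq,
        errP M (M * x ^ (-ε₁)) ⌊x ^ (2 * ε₁) * (2 * Q) * R / M⌋₊ j
          (fun d => ⌊(d : ℝ) * x ^ (ε₁ / 2) / (M * x ^ (-ε₁))⌋₊) (q * r)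
      ≤ ∑ r ∈ Icc 1 ⌊2 * R⌋₊, ∑ _l ∈ dyadic L, ∑ q ∈ Icc 1 Xq,
          c * ((σ 0 (q * r) : ℝ) / (Nat.totient (q * r) : ℝ)) := by
        calc _ ≤ ∑ r ∈ dyadic R, ∑ _l ∈ dyadic L, ∑ q ∈ Icc 1 Xq,
              c * ((σ 0 (q * r) : ℝ) / (Nat.totient (q * r) : ℝ)) :=
              Finset.sum_le_sum fun r hr => Finset.sum_le_sum fun l _ => Finset.sum_le_sum fun q hq =>
                hone r (dyadic_subset_Icc hR.le hr) q hq
          _ ≤ _ := Finset.sum_le_sum_of_subset_of_nonneg (dyadic_subset_Icc hR.le) fun r _ _ =>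
              Finset.sum_nonneg fun l _ => Finset.sum_nonneg fun q _ => mul_nonneg hc0 (hσφ0 q r)
    _ = ((dyadic L).card : ℝ) * (c * ∑ r ∈ Icc 1 ⌊2 * R⌋₊, ∑ q ∈ Icc 1 Xq,
          ((σ 0 (q * r) : ℝ) / (Nat.totient (q * r) : ℝ))) := by
        simp_rw [Finset.mul_sum]
        refine Finset.sum_congr rfl fun r _ => ?_
        rw [Finset.sum_const, nsmul_eq_mul, Finset.mul_sum]
    _ ≤ (2 * L + 1) * (c * ∑ r ∈ Icc 1 ⌊2 * R⌋₊, ∑ q ∈ Icc 1 Xq,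
          ((σ 0 (q * r) : ℝ) / (Nat.totient (q * r) : ℝ))) := by
        have h0 : 0 ≤ c * ∑ r ∈ Icc 1 ⌊2 * R⌋₊, ∑ q ∈ Icc 1 Xq,
            ((σ 0 (q * r) : ℝ) / (Nat.totient (q * r) : ℝ)) :=
          mul_nonneg hc0 (Finset.sum_nonneg fun r _ => Finset.sum_nonneg fun q _ => hσφ0 q r)
        have := card_dyadic_le_two_mul hL
        nlinarith
    _ = _ := by rw [Finset.sum_comm]; ring

end BFI

end Literature.NumberTheory.Sieve
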